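import Summits.ABC.FunctionField.TransferSheet
import Summits.ABC.Analytic.PolySzpiro
import HarnessLib

/-!
# Cell abc-ff — transfer sheet: bridges to the ladder's sub-summit Props (rung A-PS)

`Summits/ABC/FunctionField/TransferSheetLadder.lean` — theorems only. The A-PS Prop of LADDER-ABC §1,
`Summit.ABC.PolySzpiroRat` / `Summit.ABC.PolySzpiroRatEff K C` (cell abc-an, `Summits/ABC/Analytic/
PolySzpiro.lean`, p547373), landed after the sheet was typed; as promised in the sheet's docstring the
displayed `∃ K C` sentence is now swapped for the name:
* `polySzpiroWith_iff_exists_polySzpiroRatEff` — the sheet's `PolySzpiroWith K` is literally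
  `∃ C, PolySzpiroRatEff K C`;
* `polySzpiroRatEff_of_rksPolarWith` — **row CF-2 in the effective currency**: a height bound
  `12 h_F ≤ (6 + λ) log N + C` gives `PolySzpiroRatEff (6 + λ) (C + 16)` (same exponent, constant `+16`
  from Pasten's Lemma 18.1 in the tree);
* `polySzpiroRat_of_rksPolar`, `polySzpiroRat_of_rks` — `R_KSλ ⟹ A-PS`, `R_KS ⟹ A-PS`.
HONESTY: abc is not proved by any of this; A-PS is NOT abc — «NOT abc — POLY-SZPIRO(E)» (D-0139); the
hypotheses are the sheet's conjectural requirements.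
-/

noncomputable section

open WeierstrassCurve

namespace Summit.ABC.FunctionField

/-- The sheet's parametric shape is the ladder's effective Prop with the constant existentially
quantified: `PolySzpiroWith K ↔ ∃ C, PolySzpiroRatEff K C` (definitional). [folklore] -/
theorem polySzpiroWith_iff_exists_polySzpiroRatEff (K : ℝ) :
    PolySzpiroWith K ↔ ∃ C : ℝ, Summit.ABC.PolySzpiroRatEff K C := Iff.rfl

/-- **Row CF-2, effective currency (rung A-PS-eff):** an arithmetic Kodaira–Spencer output with EXPLICIT
`λ` and `C`, `12 h_F(E) ≤ (6 + λ) log N_E + C` for all `E/ℚ`, gives `PolySzpiroRatEff (6 + λ) (C + 16)` —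
«NOT abc — POLY-SZPIRO(6 + λ)», effective in `(λ, C)`. [folklore] -/
theorem polySzpiroRatEff_of_rksPolarWith {lam C : ℝ}
    (h : ∀ (W : WeierstrassCurve ℚ) [W.IsElliptic],
      12 * W.faltingsHeight ≤ (6 + lam) * Real.log (W.conductorNorm ℤ : ℝ) + C) :
    Summit.ABC.PolySzpiroRatEff (6 + lam) (C + 16) := by
  intro W _
  have h1 := log_minimalDiscriminantNorm_lt W
  have h2 := h W
  linarith

/-- **Row CF-2 ⟹ rung A-PS by name:** `R_KSλ ⟹ Summit.ABC.PolySzpiroRat` (`K = 6 + λ`).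
«NOT abc — POLY-SZPIRO(6 + λ)». [folklore] -/
theorem polySzpiroRat_of_rksPolar {lam : ℝ} (h : RKSPolar lam) : Summit.ABC.PolySzpiroRat := by
  obtain ⟨C, hC⟩ := h
  exact ⟨6 + lam, C + 16, polySzpiroRatEff_of_rksPolarWith hC⟩

/-- `R_KS ⟹ A-PS` (through `λ = 1`; of course also through `rks_iff_abc` and `polySzpiroRat_of_abc`).
[folklore] -/
theorem polySzpiroRat_of_rks (h : RKS) : Summit.ABC.PolySzpiroRat :=
  polySzpiroRat_of_rksPolar (h 1 one_pos)

/-- The sheet's `PolySzpiroWith K ⟹` rung A-PS by name. [folklore] -/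
theorem polySzpiroRat_of_polySzpiroWith {K : ℝ} (h : PolySzpiroWith K) : Summit.ABC.PolySzpiroRat := by
  obtain ⟨C, hC⟩ := h
  exact ⟨K, C, hC⟩

end Summit.ABC.FunctionField

end
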